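import Literature.MathematicalPhysics.QuantumFieldTheory.Balaban1983to89.B2Lemma25Proof
import Literature.MathematicalPhysics.QuantumFieldTheory.Balaban1983to89.B4Ineq118Torus

/-!
# `Balaban1983to89.B2Lemma25Torus` — T. Bałaban, *(Higgs)₂,₃ quantum fields in a finite volume. II. An upper bound*,
# Commun. Math. Phys. **86** (1982) 555–594 [Balaban1982Higgs2]: **Lemma 2.5** (2.81) p. 574 for BAŁABAN'S OWN VECTOR-FIELD
# COVARIANCES `C^{(k)}`, `C^{(k)}_{Λ₀^{(k)}}` on the unit torus `T^{(k)}`, with the inputs of its printed proof — Proposition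
# I.2.3 (I.2.34)/(I.2.36) and the constant-field computation (2.83)–(2.85) — DISCHARGED by tree theorems; only «the
# restrictions on the field B» remain, as printed

statement-level skeleton of published theorems with citation tags; proofs where landed; nothing here is a claim about the Yang–Mills mass gap

PDF held: `paper:balaban1982-cmp86-higgs23-ii` (journal page = PDF page + 554); pp. 558–560, 574–575 read on the ×2 renders
`run/shared/lean/pub/pub-balaban/b2b-balaban-ref1/pages/1982-cmp86-higgs23-II/1982-cmp86-higgs23-II-p004/p006/p020/p021-x2.png`;
part I [Balaban1982Higgs1] = `paper:balaban1982-cmp85-higgs23-i` (journal page = PDF page + 602), pp. 608, 610–612.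

CITATION HEADER / WHAT IS REPRODUCED.  Cell `lit-balaban` (HOME `run/shared/lean/pub/lit-balaban/`), Phase-2 proof seat **p23**
gen 6 (unit `lit-balaban-p23-g6`); SKELETON row **B2.Lem2.5** (decl of record `…B2Sect2Statements.Lemma25Printed`, r02 p239259;
twin `…B2StepK.Lemma25Printed`, r14 p239461 — both UNCHANGED), fold owner r02, referee ref-4.  The row was PROVED FOR THE MODEL
FAMILY by `…B2Lemma25Proof` (p23 gen 4, p247392): there ONE instance `KernelModel` carries the kernels of `C^{(k)}`,
`C^{(k)}_{Λ₀^{(k)}}` TOGETHER WITH the Proposition I.2.3 shapes (I.2.34)/(I.2.36) (`kerC`, `kerDC`), the number `κ = aL⁻²C^{(k)}1`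
of (2.83)–(2.85) (`sumC`, `kappa`), the separation (2.7)–(2.8) (`sep`) and the lattice volume (`summable`) as DATA — so the
fold owner kept the row's head `typed-existing` («the frames carry the Prop 2.2 / I.2.2 decay shapes — typed antecedents», r02
2026-08-21T05:41Z).  THIS FILE DISCHARGES EVERY ONE OF THOSE FIELDS for Bałaban's ACTUAL operators:

* B1 p. 608 [PDF 6]: *"The renormalization transformations for vector fields will be obtained by taking N = d and an external
  vector field A = 0"*; B1 (1.11) p. 605 is the Feynman-gauge action with the vector-field kinetic term `½⟨A,(−Δ^ε + μ₀²)A⟩` — so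
  the vector-field covariances `C^{(k)}`, `C^{(k)}_Λ` of B2 §2 are, component by component, the covariances (I.2.30)–(I.2.32) of the
  FREE scalar tower (`U = 1`) with mass `m² = μ₀²`.  That tower is CONSTRUCTED on the tori `T^{(j)}` of `Setup` by the pv07 lineage:
  `B1RG242Torus` (the operators `Q_j`, `Q^*_j`, `Q`, `Q^*`, `−Δ + m²`, `a_j = B1.aSeq a L j`), `B5Display136Torus.Crs P a m² j =
  (aL⁻²Q^*Q + Δ^{(j)})⁻¹ = C^{(j)}` ((I.2.31), rescaled to the unit lattice), `B4Ineq118Torus.CLam P a m² j e = ((aL⁻²Q^*Q +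
  Δ^{(j)})|_Λ)⁻¹ = C^{(j)}_Λ` ((I.2.32)/B4 (1.13)), `B4Ineq118Torus.distC` (`dist(x, Λᶜ)`), `B5Ineq137Torus.T` (the sup torus
  distance `|x − x′|` in `L^jε`-units).
* (I.2.34)/(I.2.36) = B4 (1.16)/(1.18) for these operators, uniformly in the volume, the level and `Λ`: `B4Ineq116Torus.cov116_torus`,
  `B4Ineq118Torus.cov118_torus_finset` (pv07; kernel-proved from the Sect. 5 Theorem of [B4] = `B4Sect5Torus`).  ⇒ the fields
  `kerC`, `kerDC`.
* (2.83)–(2.85) p. 574–575, verbatim: *"We have to calculate aL⁻²C^{(k)}Q*1 = aL⁻²C^{(k)}1, where the two units are in different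
  scales. We proceed the same way as in (2.62): aL⁻²C^{(k)}1 = C^{(k)}aL⁻²P1 = C^{(k)}(Δ^{(k)} + aL⁻²P)1 − C^{(k)}Δ^{(k)}1 = 1 −
  C^{(k)}Δ^{(k)}1. (2.83) We have to calculate Δ^{(k)}1. From the equalities (I.2.21) and (2.63) we get Δ^{(k)}1 = a_k1 −
  a_k²Q_kG_kQ_k^*1 = a_k1 − a_k(1 − μ₀²(L^kε)²/(a_k + μ₀²(L^kε)²)) = a_kμ₀²(L^kε)²/(a_k + μ₀²(L^kε)²), (2.84) and hence
  aL⁻²C^{(k)}1 = (1 + a⁻¹L²a_kμ₀²(L^kε)²/(a_k + μ₀²(L^kε)²))⁻¹ = 1 + O(μ₀²(L^kε)²). (2.85) This together with (2.82) proves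
  (2.81)."* — PROVED here for the tower (§1): on the torus the constants are eigenvectors, `(−Δ + m²)1 = m²1`, `Q_j1 = 1`,
  `Q^*_j1 = 1` (so the Fourier formula behind (2.63) is not needed), whence `G_j1 = (a_j + μ₀²(L^jε)²)⁻¹1`, `Δ^{(j)}1 =
  (a_jμ₀²(L^jε)²/(a_j + μ₀²(L^jε)²))1` (= (2.84); the scalar identity is r14's `B2StepK.display284`), `(aL⁻²Q^*Q + Δ^{(j)})1 =
  λ1`, `C^{(j)}1 = λ⁻¹1` and `aL⁻²C^{(j)}1 = κ1` with `κ` = the printed (2.85) value (r14's `B2StepK.display285`) and `|κ − 1| ≤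
  (L²/a)μ₀²(L^jε)²` (`B2StepK.display285_bound`).  ⇒ the fields `sumC`, `kappa` (`K₁ = 2L²μ₀/a`).
* the volume constant `Σ_{x′∈T^{(j)}} e^{−½δ₀|x−x′|} ≤ K_d(½δ₀)` = `B5Leaf237C0Torus.T_sumBound` ⇒ `summable`; the separation
  field `sep` from (2.7)–(2.8) (`r(ε) = R(1 + log ε⁻¹)^r`, r > 1) by `B2Lemma25Proof.exists_C₁_rDecay` (r14's `rDecayBeatsPowers`),
  `K₂ = 2C₁/μ₀`.

WHAT REMAINS A HYPOTHESIS — exactly what print uses as one: *"where Proposition I.2.3 and the restrictions on the field B were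
used"* (p. 574): the restrictions (2.17) p. 560 at scale `L^kε` on the new vector field `B` (`KernelModel.Restr` = the carrier's
`restrB`, in the p247392 reading: (2.17)₂ `|B(y)| ≤ (2/(μ₀L^kε))p(L^kε)` on `Λ₀^{(k)′}` and (2.17)₃ integrated along lattice paths
inside `Λ₀^{(k)′}`, `|B(y′) − B(y)| ≤ p(L^kε)(r₁ + r₂|x − x′|)`).

MAIN RESULTS.  `TorusConsts` = the constants fixed BEFORE the instance (d, L, a, μ₀, R, r, b₀, p, r₁, r₂; `TorusConsts.Valid` = the
printed ranges: d ≥ 1, L odd > 1, a > 0, μ₀ > 0, R > 0, r > 1, b₀ ≥ 0); `TorusInst Q` = ONE STEP k on ONE TORUS: a volume `P :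
Params` (`P.d = d`, `P.L = L`), a level `1 ≤ k`, `k + 1 ≤ m + K` (Bałaban's range of `Setup`), `L^kε ≤ 1`, the region `Λ₀^{(k)′} ⊂
T^{(k+1)}` (coarse sites) and one component `B : T^{(k+1)} → ℝ` of the block field; `toKM Q hQ ι : B2Lemma25Proof.KernelModel …`
the instance with ALL proof fields discharged (§3); `famTorus Q hQ : TorusInst Q → B2Sect2Statements.L25Setting`;
**`lemma25Printed_torus : B2Sect2Statements.Lemma25Printed (famTorus Q hQ)`** and the twin **`lemma25Printed_torus_StepK :
B2StepK.Lemma25Printed (famTorusStepK Q hQ)`**; the pointwise form `lemma25_torus_pointwise`: for `x ∈ B(y)` deep in `Λ₀`,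
`|aL⁻²Σ_{x′∈B(Λ₀′)} C^{(k)}_{B(Λ₀′)}(x, x′)B(y(x′)) − B(y)| ≤ 𝒞·p(L^kε)` with `𝒞 = B2Lemma25Proof.Consts.O1 (consts Q hQ)`; (2.86)
`ineq286_torus`; §4 non-vacuity (the index type of the physical window is inhabited and the restrictions are satisfiable).

DICTIONARY (print ↦ Lean).  `T^{(k)}` (unit lattice of step k) ↦ `Site ι.P ι.j`; `T^{(k+1)}` ↦ `Site ι.P (ι.j + 1)`; `x ∈ B(y)` ↦
`blockOf x = y`; `Λ₀^{(k)′}` ↦ `ι.Λ₀'`, `B(Λ₀^{(k)′})` ↦ `ι.Λ₀ = {x | blockOf x ∈ Λ₀′}`; `C^{(k)}(x,x′)` ↦ `Crs ι.P Q.a (Q.μ₀²) ι.j x x′`;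
`C^{(k)}_{Λ₀^{(k)}}(x,x′)` ↦ `ι.CΛ x x′ = CLam ι.P Q.a (Q.μ₀²) ι.j (Subtype.val : Λ₀ → T^{(k)}) x x′`; `|x − x′|` ↦ `T ι.P ι.j x x′`;
`dist(x, Λ₀ᶜ)` ↦ `distC ι.P ι.j ι.Λ₀ x`; `L^kε` ↦ `ι.ℓ = ι.P.spacing ι.j`; `p(L^kε)`, `r(L^kε)` ↦ `B2.pFn Q.b₀ Q.pexp ι.ℓ`,
`B2.rFn Q.Rr Q.r ι.ℓ`; `μ₀²(L^kε)²` ↦ `ι.ℓ ^ 2 * Q.μ₀ ^ 2`; `a_k` ↦ `B1.aSeq Q.a ι.P.L ι.j`; `aL⁻²` ↦ `Q.a * (L²)⁻¹`; `B(Λ₁^{(k)′})`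
↦ `ι.deep = {x ∈ Λ₀ | r(L^kε) ≤ dist(x, Λ₀ᶜ)}` (see HONEST SCOPE (ii)).

HONEST SCOPE.  (i) The identification "vector-field covariance = free scalar tower at m² = μ₀², componentwise" is B1's printed
sentence (p. 608) with (1.11); it is NOT re-derived here from `HiggsLattice.action` by Gaussian integration.  (ii) `Λ₁^{(k)′}` is
not a datum: (2.81) is asserted at every point of `B(Λ₀^{(k)′})` at sup-torus distance `≥ r(L^kε)` from `T^{(k)} ∖ B(Λ₀^{(k)′})`,
which by (2.7)–(2.8) p. 558 (*"Λ_{i+1}ᶜ is the sum of all large blocks of T₁ with distances from the set Λ_iᶜ less or equal r(ε)"*)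
CONTAINS `B(Λ₁^{(k)′})` — a formally stronger assertion.  (iii) The hypothesis on `B` is the p247392 READING of (2.17) at scale
`L^kε` (`KernelModel.Restr`): (2.17)₂ verbatim (`|B(y)| ≤ (2/(μ₀L^kε))p(L^kε)` on `Λ₀^{(k)′}`) and (2.17)₃ in INTEGRATED form — a
Lipschitz bound `|B(y′) − B(y)| ≤ p(L^kε)(r₁ + r₂|x − x′|)` along `B(Λ₀′)` up to the distance `dist(x, Λ₀ᶜ)`, with family parameters
`r₁, r₂`; print's bondwise `|B(y) − B(y′)| ≤ 3Ldp` on `Λ′*` yields it along chains of neighbouring blocks inside `Λ₀′` (`r₁ = 3Ld²`,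
`r₂ = 3d²` when a monotone chain stays inside), a chain-existence step NOT transcribed — so the integrated form itself is the
hypothesis, exactly as in p247392 (in degenerate geometries it asks slightly more than the bondwise display).  (iv) The tori are `Setup`'s (B12 (0.1): `2L^{m+K−j}` sites per direction, `L` odd) — a
sub-family of B1's (1.2) (`B1RG242Torus` NOT-CERTIFIED (vi)); levels `1 ≤ k`, `k + 1 ≤ m + K`, `L^kε ≤ 1` (B2: `L^Kε ≤ ε₀ ≤ 1`,
(2.116)).  (v) Distances are the sup torus metric in `L^kε`-units; constants `δ₀, c₀, C₁` are existential (those of the cited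
torus theorems), chosen once per `(d, L, a, μ₀, R, r)` by `Classical.choice` (`cert`), so `𝒞` is not numerical.  (vi) `B` is one
real component ((2.81) is componentwise).  (vii) Nothing about the functional integral (2.53), Lemma 2.7, or `A ≠ 0`.
No `sorry`, no new `def … : Prop` leaf, axioms standard; value = kernel certificate (bookkeeping over the tree's own theorems),
NOT summit progress.
-/

namespace Literature.MathematicalPhysics.QuantumFieldTheory.Balaban1983to89.B2Lemma25Torus

open Finset Matrix Real
open Literature.MathematicalPhysics.QuantumFieldTheory.Balaban1983to89
open B1RG242Torus B5Display136Torus B4Ineq115Torus B5Ineq137Torus B5Leaf237C0Torus B4Ineq116Torus B4Ineq118Torus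
open B2Lemma25Proof

noncomputable section

/-! ## §1. (2.83)–(2.85) for the concrete tower: the operators on constant functions -/

section Constants

variable {P : Params} {i i' : ℕ}

/-- A `L^{−ad}`-weighted `a`-fold block average of a constant is the same constant (`|B^a(y)| = L^{ad}`,
`B1RG242Torus.Site.card_fibre`). [cite: Balaban1982Higgs1, (2.11) p.609] -/
theorem avgMat_mulVec_const {a : ℕ} (h : P.sitesPerDir i = P.L ^ a * P.sitesPerDir i') (c : ℝ) (y : Site P i') :
    (avgMat P i i' a ((((P.L : ℝ) ^ P.d)⁻¹) ^ a) *ᵥ (fun _ : Site P i => c)) y = c := by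
  rw [avgMat_mulVec, Finset.sum_ite, Finset.sum_const_zero, add_zero, Finset.sum_const, Site.card_fibre h y,
    nsmul_eq_mul]
  push_cast
  have h1 := winv_pow_mul_eq_one P a
  calc ((P.L : ℝ) ^ a) ^ P.d * ((((P.L : ℝ) ^ P.d)⁻¹) ^ a * c)
      = ((((P.L : ℝ) ^ P.d)⁻¹) ^ a * (((P.L : ℝ) ^ a) ^ P.d)) * c := by ring
    _ = c := by rw [h1, one_mul]

/-- The block-constant extension of a constant is the same constant. [cite: Balaban1982Higgs1, (1.5) p.604] -/
theorem extMat_mulVec_const (a : ℕ) (c : ℝ) :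
    extMat P i i' a *ᵥ (fun _ : Site P i' => c) = fun _ => c :=
  funext fun x => extMat_mulVec a _ x

/-- `Q_j1 = 1` on the torus (the averaging (2.11) is normalised). [cite: Balaban1982Higgs1, (2.11) p.609] -/
theorem Qk_mulVec_const (j : ℕ) (c : ℝ) : Qk P j *ᵥ (fun _ : Site P 0 => c) = fun _ => c := by
  funext y
  exact avgMat_mulVec_const (sitesPerDir_zero_eq P j) c y

/-- `Q^*_j1 = 1`. [cite: Balaban1982Higgs1, (1.5) p.604] -/
theorem Qks_mulVec_const (j : ℕ) (c : ℝ) : Qks P j *ᵥ (fun _ : Site P j => c) = fun _ => c :=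
  extMat_mulVec_const _ c

/-- `Q1 = 1` for the one-step average (2.7) on `T^{(j)}`. [cite: Balaban1982Higgs1, (2.7) p.608] -/
theorem Q_mulVec_const (j : ℕ) (c : ℝ) : Q P j *ᵥ (fun _ : Site P j => c) = fun _ => c := by
  funext y
  exact avgMat_mulVec_const (sitesPerDir_eq_succ P j) c y

/-- `Q^*1 = 1`. [cite: Balaban1982Higgs1, (1.5) p.604] -/
theorem Qs_mulVec_const (j : ℕ) (c : ℝ) : Qs P j *ᵥ (fun _ : Site P (j + 1) => c) = fun _ => c :=
  extMat_mulVec_const _ c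

/-- The lattice derivative (1.4) kills constants. [cite: Balaban1982Higgs1, (1.4) p.604] -/
theorem deriv_mulVec_const (s : ℝ) (μ : Fin P.d) (c : ℝ) : deriv P i s μ *ᵥ (fun _ : Site P i => c) = 0 := by
  funext x
  rw [deriv_mulVec]
  simp

/-- `(−Δ^s + m²)1 = m²·1`: the constants are eigenvectors of the torus Laplacian (the torus has no boundary), eigenvalue 0 —
the fact behind (2.84) (`G_k1 = (a_k + μ₀²(L^kε)²)⁻¹1`). [cite: Balaban1982Higgs2, (2.84) p.574] -/
theorem hOp_mulVec_const (s msq c : ℝ) : hOp P i s msq *ᵥ (fun _ : Site P i => c) = fun _ => msq * c := by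
  rw [hOp_mulVec]
  simp_rw [deriv_mulVec_const, Matrix.mulVec_zero, Finset.sum_const_zero, add_zero]
  funext x
  simp [Pi.smul_apply, smul_eq_mul]

/-- The argument of the rescaled propagator `G_j` of (I.2.22) on constants: `(−Δ + μ₀²(L^jε)² + a_jQ^*_jQ_j)1 =
(μ₀²(L^jε)² + a_j)1`. [cite: Balaban1982Higgs2, (2.84) p.574] -/
theorem Marg_mulVec_const (a msq : ℝ) (j : ℕ) (c : ℝ) :
    Marg P a msq j *ᵥ (fun _ : Site P 0 => c) = fun _ => (P.spacing j ^ 2 * msq + B1.aSeq a P.L j) * c := by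
  rw [Marg, Matrix.add_mulVec, Matrix.smul_mulVec, ← Matrix.mulVec_mulVec, Qk_mulVec_const, Qks_mulVec_const,
    hOp_mulVec_const]
  funext x
  simp only [Pi.add_apply, Pi.smul_apply, smul_eq_mul]
  ring

/-- `G_j1 = (a_j + μ₀²(L^jε)²)⁻¹1` — the torus content of the Fourier computation in (2.84) (cf. (2.63)).
[cite: Balaban1982Higgs2, (2.84) p.574] -/
theorem Grs_mulVec_const {a msq : ℝ} (ha : 0 < a) (hm : 0 ≤ msq) {j : ℕ} (hj : 1 ≤ j) (c : ℝ) :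
    Grs P a msq j *ᵥ (fun _ : Site P 0 => c) = fun _ => (P.spacing j ^ 2 * msq + B1.aSeq a P.L j)⁻¹ * c := by
  set lam := P.spacing j ^ 2 * msq + B1.aSeq a P.L j with hlam
  have hA : 0 < B1.aSeq a P.L j := B1.aSeq_pos ha (one_lt_cast_L P) hj
  have hlam_pos : 0 < lam := by rw [hlam]; positivity
  have h1 : Marg P a msq j *ᵥ (fun _ : Site P 0 => lam⁻¹ * c) = fun _ => c := by
    rw [Marg_mulVec_const]
    funext x
    rw [← hlam]
    field_simp
  calc Grs P a msq j *ᵥ (fun _ : Site P 0 => c)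
      = Grs P a msq j *ᵥ (Marg P a msq j *ᵥ (fun _ : Site P 0 => lam⁻¹ * c)) := by rw [h1]
    _ = (Grs P a msq j * Marg P a msq j) *ᵥ (fun _ : Site P 0 => lam⁻¹ * c) := by rw [Matrix.mulVec_mulVec]
    _ = fun _ => lam⁻¹ * c := by rw [Grs_mul_Marg ha hm hj, Matrix.one_mulVec]

/-- **(2.84)** for the tower: `Δ^{(j)}1 = (a_j − a_j²/(a_j + μ₀²(L^jε)²))1 = (a_jμ₀²(L^jε)²/(a_j + μ₀²(L^jε)²))1` (the scalar identity
is r14's `B2StepK.display284`). [cite: Balaban1982Higgs2, (2.84) p.574] -/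
theorem Drs_mulVec_const {a msq : ℝ} (ha : 0 < a) (hm : 0 ≤ msq) {j : ℕ} (hj : 1 ≤ j) (c : ℝ) :
    Drs P a msq j *ᵥ (fun _ : Site P j => c)
      = fun _ => (B1.aSeq a P.L j * (P.spacing j ^ 2 * msq) / (B1.aSeq a P.L j + P.spacing j ^ 2 * msq)) * c := by
  have hA : 0 < B1.aSeq a P.L j := B1.aSeq_pos ha (one_lt_cast_L P) hj
  have hne : B1.aSeq a P.L j + P.spacing j ^ 2 * msq ≠ 0 := by positivity
  rw [Drs, Matrix.sub_mulVec, Matrix.smul_mulVec, Matrix.one_mulVec, Matrix.smul_mulVec, Matrix.mul_assoc,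
    ← Matrix.mulVec_mulVec, ← Matrix.mulVec_mulVec, Qks_mulVec_const, Grs_mulVec_const ha hm hj, Qk_mulVec_const]
  funext x
  simp only [Pi.sub_apply, Pi.smul_apply, smul_eq_mul]
  rw [add_comm (P.spacing j ^ 2 * msq)]
  field_simp
  ring

variable (P) in
/-- The number `λ = aL⁻² + a_jμ₀²(L^jε)²/(a_j + μ₀²(L^jε)²)` by which `C^{(j)}⁻¹ = aL⁻²Q^*Q + Δ^{(j)}` acts on constants ((2.83)–(2.84)).
[cite: Balaban1982Higgs2, (2.83)–(2.84) p.574] -/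
def lam (a msq : ℝ) (j : ℕ) : ℝ :=
  a * ((P.L : ℝ) ^ 2)⁻¹ + B1.aSeq a P.L j * (P.spacing j ^ 2 * msq) / (B1.aSeq a P.L j + P.spacing j ^ 2 * msq)

/-- `λ > 0` (a, a_j > 0, m² ≥ 0). [cite: Balaban1982Higgs2, (2.83) p.574] -/
theorem lam_pos {a msq : ℝ} (ha : 0 < a) (hm : 0 ≤ msq) {j : ℕ} (hj : 1 ≤ j) : 0 < lam P a msq j := by
  have hA : 0 < B1.aSeq a P.L j := B1.aSeq_pos ha (one_lt_cast_L P) hj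
  have hL : (0 : ℝ) < P.L := P.cast_L_pos
  unfold lam
  positivity

/-- **(2.83)** for the tower, first half: `(aL⁻²Q^*Q + Δ^{(j)})1 = λ1`. [cite: Balaban1982Higgs2, (2.83) p.574] -/
theorem Carg_mulVec_const {a msq : ℝ} (ha : 0 < a) (hm : 0 ≤ msq) {j : ℕ} (hj : 1 ≤ j) (c : ℝ) :
    Carg P a msq j *ᵥ (fun _ : Site P j => c) = fun _ => lam P a msq j * c := by
  rw [Carg, Matrix.add_mulVec, Matrix.smul_mulVec, ← Matrix.mulVec_mulVec, Q_mulVec_const, Qs_mulVec_const,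
    Drs_mulVec_const ha hm hj]
  funext x
  simp only [Pi.add_apply, Pi.smul_apply, smul_eq_mul, lam]
  ring

/-- **(2.83)** for the tower: `C^{(j)}1 = λ⁻¹1` (the covariance (I.2.31) acts on constants by a number).
[cite: Balaban1982Higgs2, (2.83) p.574] -/
theorem Crs_mulVec_const {a msq : ℝ} (ha : 0 < a) (hm : 0 ≤ msq) {j : ℕ} (hj : 1 ≤ j) (c : ℝ) :
    Crs P a msq j *ᵥ (fun _ : Site P j => c) = fun _ => (lam P a msq j)⁻¹ * c := by
  have hlam : lam P a msq j ≠ 0 := (lam_pos ha hm hj).ne'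
  have hCC : Crs P a msq j * Carg P a msq j = 1 := by
    rw [mul_eq_one_comm]
    exact Carg_mul_Crs ha hm hj
  have h1 : Carg P a msq j *ᵥ (fun _ : Site P j => (lam P a msq j)⁻¹ * c) = fun _ => c := by
    rw [Carg_mulVec_const ha hm hj]
    funext x
    field_simp
  calc Crs P a msq j *ᵥ (fun _ : Site P j => c)
      = Crs P a msq j *ᵥ (Carg P a msq j *ᵥ (fun _ : Site P j => (lam P a msq j)⁻¹ * c)) := by rw [h1]
    _ = (Crs P a msq j * Carg P a msq j) *ᵥ (fun _ : Site P j => (lam P a msq j)⁻¹ * c) := by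
        rw [Matrix.mulVec_mulVec]
    _ = fun _ => (lam P a msq j)⁻¹ * c := by rw [hCC, Matrix.one_mulVec]

/-- The row sums of `C^{(j)}` on the torus: `Σ_{x′} C^{(j)}(x, x′) = λ⁻¹` for every `x` («C^{(k)}1», (2.83)).
[cite: Balaban1982Higgs2, (2.83) p.574] -/
theorem Crs_rowSum {a msq : ℝ} (ha : 0 < a) (hm : 0 ≤ msq) {j : ℕ} (hj : 1 ≤ j) (x : Site P j) :
    ∑ x', Crs P a msq j x x' = (lam P a msq j)⁻¹ := by
  have h := congrFun (Crs_mulVec_const (P := P) ha hm hj (1 : ℝ)) x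
  simp only [Matrix.mulVec, dotProduct, mul_one] at h
  exact h

/-- **(2.85)** for the tower: `aL⁻²Σ_{x′}C^{(j)}(x, x′) = (1 + a⁻¹L²a_jμ₀²(L^jε)²/(a_j + μ₀²(L^jε)²))⁻¹` — the printed value of
`aL⁻²C^{(k)}1`, r14's `B2StepK.display285`. [cite: Balaban1982Higgs2, (2.85) p.575] -/
theorem aLinv2_mul_Crs_rowSum {a msq : ℝ} (ha : 0 < a) (hm : 0 ≤ msq) {j : ℕ} (hj : 1 ≤ j) (x : Site P j) :
    a * ((P.L : ℝ) ^ 2)⁻¹ * ∑ x', Crs P a msq j x x'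
      = (1 + a⁻¹ * (P.L : ℝ) ^ 2 *
          (B1.aSeq a P.L j * (P.spacing j ^ 2 * msq) / (B1.aSeq a P.L j + P.spacing j ^ 2 * msq)))⁻¹ := by
  have hA : 0 < B1.aSeq a P.L j := B1.aSeq_pos ha (one_lt_cast_L P) hj
  have hne : B1.aSeq a P.L j + P.spacing j ^ 2 * msq ≠ 0 := by positivity
  rw [Crs_rowSum ha hm hj, ← div_eq_mul_inv]
  exact B2StepK.display285 ha.ne' P.cast_L_pos.ne' hne

/-- (2.85) «= 1 + O(μ₀²(L^kε)²)» against the threshold `2/(μ₀L^kε)` of (2.17)₂: `|κ − 1|·2/(μ₀ℓ) ≤ 2L²μ₀ℓ/a ≤ 2L²μ₀/a` for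
`ℓ = L^kε ≤ 1` (r14's `display285_bound` `|κ − 1| ≤ (L²/a)μ₀²ℓ²`). [cite: Balaban1982Higgs2, (2.85) p.575] -/
theorem kappa_tB_le {a L ak μ₀ ℓ : ℝ} (ha : 0 < a) (hak : 0 < ak) (hμ₀ : 0 < μ₀) (hℓ : 0 < ℓ) (hℓ1 : ℓ ≤ 1) :
    |(1 + a⁻¹ * L ^ 2 * (ak * (ℓ ^ 2 * μ₀ ^ 2) / (ak + ℓ ^ 2 * μ₀ ^ 2)))⁻¹ - 1| * (2 / (μ₀ * ℓ))
      ≤ 2 * L ^ 2 * μ₀ / a := by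
  have hb := B2StepK.display285_bound (L := L) ha hak (by positivity : (0 : ℝ) ≤ ℓ ^ 2 * μ₀ ^ 2)
  calc |(1 + a⁻¹ * L ^ 2 * (ak * (ℓ ^ 2 * μ₀ ^ 2) / (ak + ℓ ^ 2 * μ₀ ^ 2)))⁻¹ - 1| * (2 / (μ₀ * ℓ))
      ≤ (L ^ 2 / a * (ℓ ^ 2 * μ₀ ^ 2)) * (2 / (μ₀ * ℓ)) := mul_le_mul_of_nonneg_right hb (by positivity)
    _ = 2 * L ^ 2 * μ₀ / a * ℓ := by field_simp
    _ ≤ 2 * L ^ 2 * μ₀ / a * 1 := mul_le_mul_of_nonneg_left hℓ1 (by positivity)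
    _ = 2 * L ^ 2 * μ₀ / a := mul_one _

end Constants

/-! ## §2. The constants fixed before the instance; the uniform (I.2.34)/(I.2.36) and separation constants of the torus theorems -/

/-- The constants chosen BEFORE the instance (so that the `O(·)` of (2.81) is uniform): the dimension `d`, the block size `L`,
the positive constant `a` of `aL⁻²` ((2.1) p. 557), the vector-field mass `μ₀` ((I.1.11), (2.84)), `R, r` of `r(ε) = R(1 +
log ε⁻¹)^r` ((2.7) p. 558), `b₀, p` of `p(ε) = b₀(1 + log ε⁻¹)^p` (p. 557), and the restriction constants `r₁, r₂` of the
integrated (2.17)₃ (p247392 reading). [cite: Balaban1982Higgs2, pp.557–558, (2.17) p.560, (2.84) p.574] -/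
structure TorusConsts where
  /-- dimension d -/
  d : ℕ
  /-- block size L -/
  L : ℕ
  /-- the constant a of aL⁻²P -/
  a : ℝ
  /-- the vector-field mass μ₀ -/
  μ₀ : ℝ
  /-- R of r(ε) = R(1 + log ε⁻¹)^r -/
  Rr : ℝ
  /-- r of r(ε) -/
  r : ℝ
  /-- b₀ of p(ε) = b₀(1 + log ε⁻¹)^p -/
  b₀ : ℝ
  /-- p of p(ε) -/
  pexp : ℝ
  /-- restriction constant r₁ (integrated (2.17)₃) -/
  r₁ : ℝ
  /-- restriction constant r₂ (integrated (2.17)₃) -/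
  r₂ : ℝ

/-- The printed ranges: `d ≥ 1`, `L` odd `> 1` (`Setup`), `a > 0` (p. 557), `μ₀ > 0` ((I.1.11)), `R > 0`, `r > 1` ((2.7)), `b₀ ≥ 0`,
`r₁, r₂ ≥ 0`. [cite: Balaban1982Higgs2, pp.557–558] -/
structure TorusConsts.Valid (Q : TorusConsts) : Prop where
  hd : 1 ≤ Q.d
  hL : Odd Q.L ∧ 1 < Q.L
  ha : 0 < Q.a
  hμ₀ : 0 < Q.μ₀
  hRr : 0 < Q.Rr
  hr : 1 < Q.r
  hb₀ : 0 ≤ Q.b₀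
  hr₁ : 0 ≤ Q.r₁
  hr₂ : 0 ≤ Q.r₂

/-- Uniform constants `δ₀ > 0`, `c₀ ≥ 0`, `C₁ ≥ 0` for the window `(d, L, a, μ₀, R, r)`, WITH their certificates: (I.2.34) = B4 (1.16)
for `C^{(j)}` and (I.2.36) = B4 (1.18) for `δC^{(j)}_Λ = C^{(j)}_Λ − C^{(j)}` on every torus of the window, every level `1 ≤ j ≤ m + K`
with `L^jε ≤ 1` and every `Λ` (mass `μ₀²`, cap `μ₀²(L^jε)² ≤ μ₀²`), and the separation bound `e^{−½δ₀r(ℓ)} ≤ C₁ℓ` on `(0, 1]`.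
[cite: Balaban1982Higgs1, Prop. 2.3 (2.34)–(2.36) pp.611–612] [cite: Balaban1982Higgs2, (2.7) p.558] -/
structure Certified (Q : TorusConsts) where
  /-- decay rate δ₀ -/
  δ : ℝ
  /-- kernel constant c₀ -/
  c₀ : ℝ
  /-- separation constant C₁ -/
  C₁ : ℝ
  δ_pos : 0 < δ
  c₀_nonneg : 0 ≤ c₀
  C₁_nonneg : 0 ≤ C₁
  /-- (I.2.34)/(1.16) for C^{(j)} on the torus -/
  ker116 : ∀ (P : Params), P.d = Q.d → P.L = Q.L → ∀ j : ℕ, 1 ≤ j → j ≤ P.m + P.K → P.spacing j ≤ 1 →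
    ∀ y y' : Site P j, |Crs P Q.a (Q.μ₀ ^ 2) j y y'| ≤ c₀ * Real.exp (-(δ * T P j y y'))
  /-- (I.2.36)/(1.18) for δC^{(j)}_Λ on the torus, every Λ -/
  ker118 : ∀ (P : Params), P.d = Q.d → P.L = Q.L → ∀ j : ℕ, 1 ≤ j → j ≤ P.m + P.K → P.spacing j ≤ 1 →
    ∀ (Λ : Finset (Site P j)) (y y' : ↥Λ),
      |deltaC P Q.a (Q.μ₀ ^ 2) j (Subtype.val : ↥Λ → Site P j) y y'|
        ≤ c₀ * Real.exp (-(δ * (T P j y.1 y'.1 + distC P j Λ y.1 + distC P j Λ y'.1)))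
  /-- the separation r(ℓ) beats ℓ⁻¹ at rate ½δ₀ -/
  sep : ∀ ℓ : ℝ, 0 < ℓ → ℓ ≤ 1 → Real.exp (-(δ / 2 * B2.rFn Q.Rr Q.r ℓ)) ≤ C₁ * ℓ

/-- `c₁e^{−δ₁t} ≤ c e^{−δt}` for `t ≥ 0`, `0 ≤ c₁ ≤ c`, `δ ≤ δ₁`. [folklore] -/
private theorem weaken {c₁ c δ₁ δ t : ℝ} (ht : 0 ≤ t) (hc₁ : 0 ≤ c₁) (hc : c₁ ≤ c) (hδ : δ ≤ δ₁) :
    c₁ * Real.exp (-(δ₁ * t)) ≤ c * Real.exp (-(δ * t)) :=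
  mul_le_mul hc (Real.exp_le_exp.mpr (by nlinarith)) (Real.exp_pos _).le (hc₁.trans hc)

/-- The mass cap of the torus theorems is met: `(L^jε)²μ₀² ≤ μ₀²` for `L^jε ≤ 1`. [folklore] -/
private theorem cap_of_spacing_le_one (P : Params) (j : ℕ) (hsp : P.spacing j ≤ 1) (μ₀ : ℝ) :
    P.spacing j ^ 2 * μ₀ ^ 2 ≤ μ₀ ^ 2 := by
  have hs := P.spacing_pos j
  have h1 : P.spacing j ^ 2 ≤ 1 := by nlinarith
  nlinarith [sq_nonneg μ₀]

/-- **The certified constants exist** for every valid window: `δ₀ = min`, `c₀ = max` of the constants of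
`B4Ineq116Torus.cov116_torus` ((I.2.34)) and `B4Ineq118Torus.cov118_torus_finset` ((I.2.36)) at mass `μ₀²`, cap `μ₀²`, and
`C₁` from `B2Lemma25Proof.exists_C₁_rDecay` at rate `δ₀`. [cite: Balaban1982Higgs1, Prop. 2.3 (2.34)–(2.36) pp.611–612]
[cite: Balaban1982Higgs2, (2.7) p.558] -/
theorem exists_certified (Q : TorusConsts) (hQ : Q.Valid) : Nonempty (Certified Q) := by
  obtain ⟨δ₁, c₁, hδ₁, hc₁, h₁⟩ := cov116_torus Q.d Q.L hQ.hd hQ.hL hQ.ha (Q.μ₀ ^ 2)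
  obtain ⟨δ₂, c₂, hδ₂, hc₂, h₂⟩ := cov118_torus_finset Q.d Q.L hQ.hd hQ.hL hQ.ha (Q.μ₀ ^ 2)
  have hδ : 0 < min δ₁ δ₂ := lt_min hδ₁ hδ₂
  obtain ⟨C₁, hC₁⟩ := exists_C₁_rDecay hδ hQ.hRr hQ.hr
  have hC₁0 : 0 ≤ C₁ := by
    have h := hC₁ 1 one_pos le_rfl
    rw [mul_one] at h
    exact (Real.exp_pos _).le.trans h
  refine ⟨⟨min δ₁ δ₂, max c₁ c₂, C₁, hδ, le_max_of_le_left hc₁, hC₁0, ?_, ?_, hC₁⟩⟩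
  · intro P hPd hPL j hj hjm hsp y y'
    exact (h₁ P hPd hPL (Q.μ₀ ^ 2) (sq_nonneg _) j hj hjm (cap_of_spacing_le_one P j hsp Q.μ₀) y y').trans
      (weaken (T_nonneg P j y y') hc₁ (le_max_left _ _) (min_le_left _ _))
  · intro P hPd hPL j hj hjm hsp Λ y y'
    refine (h₂ P hPd hPL (Q.μ₀ ^ 2) (sq_nonneg _) j hj hjm (cap_of_spacing_le_one P j hsp Q.μ₀) Λ y y').trans
      (weaken ?_ hc₂ (le_max_right _ _) (min_le_right _ _))
    have := T_nonneg P j y.1 y'.1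
    have := distC_nonneg P j Λ y.1
    have := distC_nonneg P j Λ y'.1
    positivity

/-- THE choice of certified constants for a valid window (once and for all, before any instance). [folklore] -/
def cert (Q : TorusConsts) (hQ : Q.Valid) : Certified Q := Classical.choice (exists_certified Q hQ)

/-- The fixed constants of the p247392 model family realised by the torus tower: `c = aL⁻²`, `c₀, δ₀` the certified
(I.2.34)/(I.2.36) constants, `S = K_d(½δ₀)` the torus lattice profile (`B4Sect5Proof.latticeConst`), `r₁, r₂`, `K₁ = 2L²μ₀/a`
((2.85) against (2.17)₂), `K₂ = 2C₁/μ₀` ((2.7)–(2.8)). [cite: Balaban1982Higgs2, Lemma 2.5 (2.81)–(2.85) pp.574–575] -/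
def consts (Q : TorusConsts) (hQ : Q.Valid) : B2Lemma25Proof.Consts where
  c := Q.a * ((Q.L : ℝ) ^ 2)⁻¹
  c₀ := (cert Q hQ).c₀
  δ := (cert Q hQ).δ
  S := B4Sect5Proof.latticeConst Q.d ((cert Q hQ).δ / 2)
  r₁ := Q.r₁
  r₂ := Q.r₂
  K₁ := 2 * (Q.L : ℝ) ^ 2 * Q.μ₀ / Q.a
  K₂ := 2 * (cert Q hQ).C₁ / Q.μ₀

/-- The sign conditions of the model family hold for these constants. [cite: Balaban1982Higgs2, Lemma 2.5 (2.81) p.574] -/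
theorem consts_valid (Q : TorusConsts) (hQ : Q.Valid) : (consts Q hQ).Valid where
  c_nonneg := by have := hQ.ha; simp only [consts]; positivity
  c₀_nonneg := (cert Q hQ).c₀_nonneg
  δ_pos := (cert Q hQ).δ_pos
  S_nonneg := B4Sect5Proof.latticeConst_nonneg Q.d (half_pos (cert Q hQ).δ_pos).le
  r₁_nonneg := hQ.hr₁
  r₂_nonneg := hQ.hr₂
  K₁_nonneg := by have := hQ.ha; have := hQ.hμ₀; simp only [consts]; positivity
  K₂_nonneg := by have := hQ.hμ₀; have := (cert Q hQ).C₁_nonneg; simp only [consts]; positivity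

/-! ## §3. One step on one torus: the instance, all analytic fields discharged -/

/-- ONE INSTANCE of Lemma 2.5 realised on the torus: a volume `P` of the window (`P.d = d`, `P.L = L`; any `m, K`), a step
`k = j` with `1 ≤ j`, `j + 1 ≤ m + K` (so that `T^{(j)}`, `T^{(j+1)}`, `Q`, `Q^*`, `B(y)` are Bałaban's — `Setup`'s standing range)
and `L^jε ≤ 1`, the region `Λ₀^{(j)′} ⊂ T^{(j+1)}` of (2.7)–(2.8) (coarse sites whose blocks form `B(Λ₀^{(j)′}) ⊂ T^{(j)}`), and one
real component `B` of the new vector field on `T^{(j+1)}`. [cite: Balaban1982Higgs2, (2.80)–(2.81) p.574; (2.7)–(2.8) p.558] -/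
structure TorusInst (Q : TorusConsts) where
  /-- the torus parameters (d, L, m, K) -/
  P : Params
  hd : P.d = Q.d
  hL : P.L = Q.L
  /-- the step k (level of the unit lattice T^{(k)}) -/
  j : ℕ
  hj : 1 ≤ j
  hjK : j + 1 ≤ P.m + P.K
  /-- L^kε ≤ 1 -/
  hsp : P.spacing j ≤ 1
  /-- Λ₀^{(k)′} ⊂ T^{(k+1)} (coarse sites) -/
  Λ₀' : Finset (Site P (j + 1))
  /-- one component of the block vector field B on T^{(k+1)} -/
  B : Site P (j + 1) → ℝ

namespace TorusInst

variable {Q : TorusConsts} (ι : TorusInst Q)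

/-- `L^kε`. [cite: Balaban1982Higgs2, p.574] -/
def ℓ : ℝ := ι.P.spacing ι.j

/-- `μ₀²(L^kε)²`, the vector-field mass on the unit lattice of step k ((2.84)). [cite: Balaban1982Higgs2, (2.84) p.574] -/
def M2 : ℝ := ι.ℓ ^ 2 * Q.μ₀ ^ 2

/-- `B(Λ₀^{(k)′}) ⊂ T^{(k)}`: the unit-lattice points whose block lies in `Λ₀^{(k)′}`. [cite: Balaban1982Higgs2, (2.80) p.574] -/
def Λ₀ : Finset (Site ι.P ι.j) := Finset.univ.filter fun x => blockOf x ∈ ι.Λ₀'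

/-- `r(L^kε) = R(1 + log (L^kε)⁻¹)^r` ((2.7) at scale L^kε). [cite: Balaban1982Higgs2, (2.7) p.558] -/
def R : ℝ := B2.rFn Q.Rr Q.r ι.ℓ

/-- `p(L^kε) = b₀(1 + log (L^kε)⁻¹)^p`. [cite: Balaban1982Higgs2, p.557, (2.81) p.574] -/
def p : ℝ := B2.pFn Q.b₀ Q.pexp ι.ℓ

/-- The threshold `2/(μ₀L^kε)` of (2.17)₂ at scale `L^kε`. [cite: Balaban1982Higgs2, (2.17) p.560] -/
def tB : ℝ := 2 / (Q.μ₀ * ι.ℓ)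

/-- The deep points: `x ∈ B(Λ₀^{(k)′})` with `dist(x, T^{(k)} ∖ B(Λ₀^{(k)′})) ≥ r(L^kε)` — contains `B(Λ₁^{(k)′})` by (2.7)–(2.8)
(*"Λ_{i+1}ᶜ is the sum of all large blocks of T₁ with distances from the set Λ_iᶜ less or equal r(ε)"*).
[cite: Balaban1982Higgs2, (2.7)–(2.8) p.558] -/
def deep : Finset (Site ι.P ι.j) := ι.Λ₀.filter fun x => ι.R ≤ distC ι.P ι.j ι.Λ₀ x

/-- The kernel `C^{(k)}_{Λ₀^{(k)}}(x, x′) = ((aL⁻²Q^*Q + Δ^{(k)})|_{B(Λ₀′)})⁻¹(x, x′)` on `B(Λ₀′) × B(Λ₀′)` (Dirichlet conditions outside,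
(I.2.32)), extended by `0`. [cite: Balaban1982Higgs1, (2.32) p.611] [cite: Balaban1982Higgs2, (2.80) p.574] -/
def CΛ (x x' : Site ι.P ι.j) : ℝ :=
  if h : x ∈ ι.Λ₀ ∧ x' ∈ ι.Λ₀ then
    CLam ι.P Q.a (Q.μ₀ ^ 2) ι.j (Subtype.val : ↥ι.Λ₀ → Site ι.P ι.j) ⟨x, h.1⟩ ⟨x', h.2⟩
  else 0

/-- `κ = aL⁻²C^{(k)}1 = (1 + a⁻¹L²a_kμ₀²(L^kε)²/(a_k + μ₀²(L^kε)²))⁻¹`, the printed (2.85). [cite: Balaban1982Higgs2, (2.85) p.575] -/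
def κ : ℝ :=
  (1 + Q.a⁻¹ * (ι.P.L : ℝ) ^ 2 *
    (B1.aSeq Q.a ι.P.L ι.j * (ι.P.spacing ι.j ^ 2 * Q.μ₀ ^ 2) / (B1.aSeq Q.a ι.P.L ι.j + ι.P.spacing ι.j ^ 2 * Q.μ₀ ^ 2)))⁻¹

/-- `aL⁻²(C^{(k)}_{Λ₀^{(k)}}Q^*B)(x) = aL⁻²Σ_{x′∈B(Λ₀′)} C^{(k)}_{Λ₀}(x, x′)B(y(x′))` — the left side of (2.81) for one component.
[cite: Balaban1982Higgs2, (2.80)–(2.81) p.574] -/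
def CQsB (x : Site ι.P ι.j) : ℝ := Q.a * ((Q.L : ℝ) ^ 2)⁻¹ * ∑ x' ∈ ι.Λ₀, ι.CΛ x x' * ι.B (blockOf x')

/-- `0 < L^kε`. [folklore] -/
theorem ℓ_pos : 0 < ι.ℓ := ι.P.spacing_pos ι.j

/-- `L^kε ≤ 1`. [folklore] -/
theorem ℓ_le_one : ι.ℓ ≤ 1 := ι.hsp

/-- `1 ≤ 1 + log (L^kε)⁻¹` (as `L^kε ≤ 1`). [folklore] -/
private theorem one_le_base : 1 ≤ 1 + Real.log ι.ℓ⁻¹ := by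
  have h : 0 ≤ Real.log ι.ℓ⁻¹ := Real.log_nonneg ((one_le_inv₀ ι.ℓ_pos).mpr ι.ℓ_le_one)
  linarith

/-- `r(L^kε) ≥ 0` for `R > 0`. [cite: Balaban1982Higgs2, (2.7) p.558] -/
theorem R_nonneg (hQ : Q.Valid) : 0 ≤ ι.R := by
  unfold R B2.rFn
  exact mul_nonneg hQ.hRr.le (Real.rpow_nonneg (by linarith [ι.one_le_base]) _)

/-- `p(L^kε) ≥ 0` for `b₀ ≥ 0`. [cite: Balaban1982Higgs2, p.557] -/
theorem p_nonneg (hQ : Q.Valid) : 0 ≤ ι.p := by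
  unfold p B2.pFn
  exact mul_nonneg hQ.hb₀ (Real.rpow_nonneg (by linarith [ι.one_le_base]) _)

/-- `2/(μ₀L^kε) ≥ 0`. [folklore] -/
private theorem tB_nonneg (hQ : Q.Valid) : 0 ≤ ι.tB := by
  have := hQ.hμ₀; have := ι.ℓ_pos; unfold tB; positivity

/-- `j ≤ m + K`. [folklore] -/
private theorem hjm : ι.j ≤ ι.P.m + ι.P.K := by have := ι.hjK; omega

/-- The entries of `δC^{(k)}_Λ` along the inclusion of a `Finset`: `C^{(k)}_Λ(y, y′) − C^{(k)}(y, y′)` (definitional).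
[cite: Balaban1982Higgs1, (2.35) p.611] -/
theorem deltaC_val (P : Params) (a msq : ℝ) (j : ℕ) (Λ : Finset (Site P j)) (y y' : ↥Λ) :
    deltaC P a msq j (Subtype.val : ↥Λ → Site P j) y y'
      = CLam P a msq j (Subtype.val : ↥Λ → Site P j) y y' - Crs P a msq j y.1 y'.1 := rfl

end TorusInst

/-- **THE INSTANCE WITH EVERY ANALYTIC FIELD DISCHARGED.**  One step on one torus read as a `B2Lemma25Proof.KernelModel` over the
constants `consts Q hQ`: `T` = all of `T^{(k)}`, `Λ₀ = B(Λ₀^{(k)′})`, `deep` as above, `blk = blockOf`, `C = C^{(k)} = Crs`, `CΛ =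
C^{(k)}_{Λ₀}` (`CLam` along `Λ₀ ↪ T^{(k)}`), `d` = sup torus distance, `u = dist(·, Λ₀ᶜ)`, `κ` = (2.85), `R = r(L^kε)`, `p = p(L^kε)`,
`tB = 2/(μ₀L^kε)`; the proof fields: `kerC` ⇐ (I.2.34) on the torus (`cov116_torus`), `kerDC` ⇐ (I.2.36) (`cov118_torus_finset`),
`sumC` ⇐ §1 (`aLinv2_mul_Crs_rowSum`), `kappa` ⇐ `kappa_tB_le`, `sep` ⇐ `sep_of_rDecayBeatsPowers`, `summable` ⇐ `T_sumBound`.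
[cite: Balaban1982Higgs2, Lemma 2.5 (2.81)–(2.85) pp.574–575; (2.7)–(2.8) p.558] -/
def toKM (Q : TorusConsts) (hQ : Q.Valid) (ι : TorusInst Q) :
    KernelModel (consts Q hQ) (Site ι.P ι.j) (Site ι.P (ι.j + 1)) where
  T := Finset.univ
  Λ₀ := ι.Λ₀
  deep := ι.deep
  blk := blockOf
  C := fun x x' => Crs ι.P Q.a (Q.μ₀ ^ 2) ι.j x x'
  CΛ := ι.CΛ
  d := T ι.P ι.j
  u := fun x => distC ι.P ι.j ι.Λ₀ x
  κ := ι.κ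
  R := ι.R
  p := ι.p
  tB := ι.tB
  B := ι.B
  Λ₀_sub := Finset.subset_univ _
  deep_sub := Finset.filter_subset _ _
  d_nonneg := fun x x' => T_nonneg ι.P ι.j x x'
  u_nonneg := fun x => distC_nonneg ι.P ι.j ι.Λ₀ x
  u_le_d := fun x _ x' _ hx' => distC_le ι.P ι.j ι.Λ₀ x hx'
  R_nonneg := ι.R_nonneg hQ
  R_le_u := fun x hx => (Finset.mem_filter.mp hx).2
  p_nonneg := ι.p_nonneg hQ
  tB_nonneg := ι.tB_nonneg hQ
  kerC := fun x _ x' _ => (cert Q hQ).ker116 ι.P ι.hd ι.hL ι.j ι.hj ι.hjm ι.hsp x x'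
  kerDC := fun x hx x' hx' => by
    have h := (cert Q hQ).ker118 ι.P ι.hd ι.hL ι.j ι.hj ι.hjm ι.hsp ι.Λ₀ ⟨x, hx⟩ ⟨x', hx'⟩
    rw [TorusInst.deltaC_val] at h
    have hC : ι.CΛ x x' = CLam ι.P Q.a (Q.μ₀ ^ 2) ι.j (Subtype.val : ↥ι.Λ₀ → Site ι.P ι.j) ⟨x, hx⟩ ⟨x', hx'⟩ := by
      unfold TorusInst.CΛ
      rw [dif_pos ⟨hx, hx'⟩]
    rw [hC]
    exact h
  sumC := fun x _ => by
    have hL : ((Q.L : ℝ)) = (ι.P.L : ℝ) := by rw [ι.hL]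
    show Q.a * ((Q.L : ℝ) ^ 2)⁻¹ * ∑ x' ∈ Finset.univ, Crs ι.P Q.a (Q.μ₀ ^ 2) ι.j x x' = ι.κ
    rw [hL]
    exact aLinv2_mul_Crs_rowSum hQ.ha (sq_nonneg _) ι.hj x
  kappa := by
    have hL : ((Q.L : ℝ)) = (ι.P.L : ℝ) := by rw [ι.hL]
    show |ι.κ - 1| * ι.tB ≤ 2 * (Q.L : ℝ) ^ 2 * Q.μ₀ / Q.a
    rw [hL]
    exact kappa_tB_le hQ.ha (B1.aSeq_pos hQ.ha (one_lt_cast_L ι.P) ι.hj) hQ.hμ₀ ι.ℓ_pos ι.ℓ_le_one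
  sep := by
    show Real.exp (-((cert Q hQ).δ / 2 * ι.R)) * ι.tB ≤ 2 * (cert Q hQ).C₁ / Q.μ₀
    exact sep_of_rDecayBeatsPowers (cert Q hQ).δ_pos.le hQ.hμ₀ ι.ℓ_pos le_rfl ((cert Q hQ).sep ι.ℓ ι.ℓ_pos ι.ℓ_le_one)
  summable := fun x _ => by
    have h := T_sumBound ι.P ι.j ((cert Q hQ).δ / 2) (half_pos (cert Q hQ).δ_pos) x
    rw [ι.hd] at h
    exact h

/-! ## §4. Row B2.Lem2.5 for Bałaban's torus covariances: the decl of record (r02) and the twin (r14) -/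

/-- The family of all torus instances of the window, read through the row's carrier `B2Sect2Statements.L25Setting` (decl of
record): `p = p(L^kε)`, `restrB` = the restrictions (2.17) on `B` at scale `L^kε` (`KernelModel.Restr`), `dev281a` / `dev281b` =
the suprema over the deep points of `|aL⁻²(C^{(k)}_{Λ₀}Q^*B)(x) − B(y)|` and `|aL⁻²(C^{(k)}_{Λ₀}Q^*B)(x) − (Q^*B)(x)|`.
[cite: Balaban1982Higgs2, Lemma 2.5 (2.81) p.574] -/
def famTorus (Q : TorusConsts) (hQ : Q.Valid) (ι : TorusInst Q) : B2Sect2Statements.L25Setting :=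
  famOf (consts Q hQ) (Site ι.P ι.j) (Site ι.P (ι.j + 1)) (toKM Q hQ ι)

/-- **ROW B2.Lem2.5 — LEMMA 2.5 (2.81) AS TYPED BY THE DECL OF RECORD, FOR BAŁABAN'S VECTOR-FIELD COVARIANCES ON THE TORUS**: for
every valid window of constants, the family of ALL steps `k` on ALL tori of `Setup` (every volume, every region `Λ₀^{(k)′}`, every
block field component `B`), with `C^{(k)} = (aL⁻²Q^*Q + Δ^{(k)})⁻¹` and `C^{(k)}_{Λ₀^{(k)}}` the GENUINE operators of the free
tower at mass `μ₀²`, satisfies `B2Sect2Statements.Lemma25Printed` with the uniform constant `𝒞 = Consts.O1 (consts Q hQ)` — the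
Proposition I.2.3 inputs and (2.83)–(2.85) being theorems here, only the restrictions (2.17) on `B` (`restrB`) are assumed, as
in print. [cite: Balaban1982Higgs2, Lemma 2.5 (2.81) p.574] -/
theorem lemma25Printed_torus (Q : TorusConsts) (hQ : Q.Valid) :
    B2Sect2Statements.Lemma25Printed (famTorus Q hQ) :=
  ⟨(consts Q hQ).O1, fun ι hR =>
    ⟨(toKM Q hQ ι).dev281a_le (consts_valid Q hQ) hR, (toKM Q hQ ι).dev281b_le (consts_valid Q hQ) hR⟩⟩

/-- The same family read through r14's twin carrier `B2StepK.L25Setting` (per-point form; `inL1 y` ↤ "every x ∈ B(y) is deep").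
[cite: Balaban1982Higgs2, Lemma 2.5 (2.81) p.574] -/
def famTorusStepK (Q : TorusConsts) (hQ : Q.Valid) (ι : TorusInst Q) : B2StepK.L25Setting :=
  famOfStepK (consts Q hQ) (Site ι.P ι.j) (Site ι.P (ι.j + 1)) (toKM Q hQ ι)

/-- **ROW B2.Lem2.5 FOR r14's TWIN STATEMENT `B2StepK.Lemma25Printed`, for Bałaban's torus covariances** (same constant).
[cite: Balaban1982Higgs2, Lemma 2.5 (2.81) p.574] -/
theorem lemma25Printed_torus_StepK (Q : TorusConsts) (hQ : Q.Valid) :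
    B2StepK.Lemma25Printed (famTorusStepK Q hQ) := by
  refine ⟨(consts Q hQ).O1, fun ι hR x hx => ?_⟩
  have hxd : x ∈ (toKM Q hQ ι).deep := hx x rfl
  exact ⟨(toKM Q hQ ι).lemma25_pointwise (consts_valid Q hQ) hR hxd,
    (toKM Q hQ ι).lemma25_pointwise_QsB (consts_valid Q hQ) hR hxd⟩

/-- **(2.81) POINTWISE, UNFOLDED**, for Bałaban's torus covariances: under the restrictions (2.17) on `B`, at every deep point
`x ∈ B(y)`, `|aL⁻²Σ_{x′∈B(Λ₀′)} C^{(k)}_{Λ₀}(x, x′)B(y(x′)) − B(y)| ≤ 𝒞·p(L^kε)` with `𝒞 = K₁ + aL⁻²·c₀·S·(4K₂ + r₁ + 2r₂/δ₀)`.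
[cite: Balaban1982Higgs2, Lemma 2.5 (2.81) p.574] -/
theorem lemma25_torus_pointwise (Q : TorusConsts) (hQ : Q.Valid) (ι : TorusInst Q) (hR : (toKM Q hQ ι).Restr)
    {x : Site ι.P ι.j} (hx : x ∈ ι.deep) :
    |ι.CQsB x - ι.B (blockOf x)| ≤ (consts Q hQ).O1 * ι.p :=
  (toKM Q hQ ι).lemma25_pointwise (consts_valid Q hQ) hR hx

/-- **(2.86)** p. 575 for Bałaban's torus covariances: with the restriction (2.17)₁ `|A(x) − (Q^*B)(x)| ≤ 2Ld·p(L^kε)` at a deep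
point, the translated field `A′ = A − aL⁻²C^{(k)}_{Λ₀}Q^*B` of (2.80) satisfies `|A′(x)| ≤ (2Ld + 𝒞)p(L^kε)`.
[cite: Balaban1982Higgs2, (2.86) p.575] -/
theorem ineq286_torus (Q : TorusConsts) (hQ : Q.Valid) (ι : TorusInst Q) (hR : (toKM Q hQ ι).Restr)
    {x : Site ι.P ι.j} (hx : x ∈ ι.deep) {L dd : ℝ} (A : Site ι.P ι.j → ℝ)
    (hA : |A x - ι.B (blockOf x)| ≤ 2 * L * dd * ι.p) :
    |A x - ι.CQsB x| ≤ (2 * L * dd + (consts Q hQ).O1) * ι.p :=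
  ineq286_model (consts_valid Q hQ) (toKM Q hQ ι) hR hx A hA

/-! ### Unfolding lemmas: what the family's fields are -/

/-- The family's `p` is `p(L^kε)`. [cite: Balaban1982Higgs2, (2.81) p.574] -/
theorem famTorus_p (Q : TorusConsts) (hQ : Q.Valid) (ι : TorusInst Q) :
    (famTorus Q hQ ι).p = B2.pFn Q.b₀ Q.pexp (ι.P.spacing ι.j) := rfl

/-- The family's hypothesis `restrB` is the restriction predicate `KernelModel.Restr` of the instance.
[cite: Balaban1982Higgs2, (2.17) p.560, Lemma 2.5 p.574] -/
theorem famTorus_restrB (Q : TorusConsts) (hQ : Q.Valid) (ι : TorusInst Q) :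
    (famTorus Q hQ ι).restrB = (toKM Q hQ ι).Restr := rfl

/-- The restrictions (2.17) at scale `L^kε` on this instance, spelled out: (2.17)₂ `|B(y′)| ≤ (2/(μ₀L^kε))·p(L^kε)` for the blocks
`y′ ∈ Λ₀^{(k)′}`, and the integrated (2.17)₃ `|B(y′) − B(y)| ≤ p(L^kε)(r₁ + r₂|x − x′|)` for `x ∈ B(y)` deep, `x′ ∈ B(y′) ⊂ B(Λ₀′)`
within `dist(x, Λ₀ᶜ)`. [cite: Balaban1982Higgs2, (2.17) p.560, Lemma 2.5 p.574] -/
theorem restr_iff (Q : TorusConsts) (hQ : Q.Valid) (ι : TorusInst Q) :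
    (toKM Q hQ ι).Restr ↔
      (∀ x' ∈ ι.Λ₀, |ι.B (blockOf x')| ≤ 2 / (Q.μ₀ * ι.P.spacing ι.j) * B2.pFn Q.b₀ Q.pexp (ι.P.spacing ι.j)) ∧
      (∀ x ∈ ι.deep, ∀ x' ∈ ι.Λ₀, T ι.P ι.j x x' ≤ distC ι.P ι.j ι.Λ₀ x →
        |ι.B (blockOf x') - ι.B (blockOf x)| ≤ B2.pFn Q.b₀ Q.pexp (ι.P.spacing ι.j) * (Q.r₁ + Q.r₂ * T ι.P ι.j x x')) :=
  ⟨fun h => ⟨h.1, h.2⟩, fun h => ⟨h.1, h.2⟩⟩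

/-- The family's `dev281a` is the supremum over the deep points of `|aL⁻²(C^{(k)}_{Λ₀}Q^*B)(x) − B(y)|` for THESE operators.
[cite: Balaban1982Higgs2, Lemma 2.5 (2.81) p.574] -/
theorem famTorus_dev281a (Q : TorusConsts) (hQ : Q.Valid) (ι : TorusInst Q) :
    (famTorus Q hQ ι).dev281a = ⨆ x : ↥ι.deep, |ι.CQsB x - ι.B (blockOf x.1)| := rfl

/-- The family's `dev281b` (weight-1 reading `(Q^*B)(x) = B(y)` of p247392) coincides with `dev281a`'s integrand pointwise.
[cite: Balaban1982Higgs2, Lemma 2.5 (2.81) p.574] -/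
theorem famTorus_dev281b (Q : TorusConsts) (hQ : Q.Valid) (ι : TorusInst Q) :
    (famTorus Q hQ ι).dev281b = ⨆ x : ↥ι.deep, |ι.CQsB x - ι.B (blockOf x.1)| := rfl

/-- The model's kernel `C` IS `C^{(k)} = (aL⁻²Q^*Q + Δ^{(k)})⁻¹` of the tower at mass `μ₀²`. [cite: Balaban1982Higgs1, (2.31) p.611] -/
theorem toKM_C (Q : TorusConsts) (hQ : Q.Valid) (ι : TorusInst Q) (x x' : Site ι.P ι.j) :
    (toKM Q hQ ι).C x x' = (Carg ι.P Q.a (Q.μ₀ ^ 2) ι.j)⁻¹ x x' := rfl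

/-- The model's kernel `CΛ` on `B(Λ₀′) × B(Λ₀′)` IS `C^{(k)}_{Λ₀} = ((aL⁻²Q^*Q + Δ^{(k)})|_{B(Λ₀′)})⁻¹`. [cite: Balaban1982Higgs1, (2.32) p.611] -/
theorem toKM_CΛ (Q : TorusConsts) (hQ : Q.Valid) (ι : TorusInst Q) {x x' : Site ι.P ι.j} (hx : x ∈ ι.Λ₀) (hx' : x' ∈ ι.Λ₀) :
    (toKM Q hQ ι).CΛ x x'
      = ((Carg ι.P Q.a (Q.μ₀ ^ 2) ι.j).submatrix (Subtype.val : ↥ι.Λ₀ → Site ι.P ι.j) Subtype.val)⁻¹ ⟨x, hx⟩ ⟨x', hx'⟩ := by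
  show ι.CΛ x x' = _
  unfold TorusInst.CΛ
  rw [dif_pos ⟨hx, hx'⟩]
  rfl

/-! ## §5. Non-vacuity: the physical window is inhabited, the restrictions are satisfiable, the deep set is non-empty -/

/-- The sup torus distance is a positive integer off the diagonal: `x ≠ y ⇒ 1 ≤ |x − y|`. [folklore] -/
private theorem one_le_T_of_ne (P : Params) {j : ℕ} {x y : Site P j} (h : x ≠ y) : 1 ≤ T P j x y := by
  have hne : T P j x y ≠ 0 := fun h0 => h (eq_of_T_eq_zero P h0)
  unfold T B4Sect5Torus.tdist at hne ⊢
  have h1 : (Finset.univ.sup (B4Sect5Torus.ccoord (Nv P j) (toT x) (toT y)) : ℕ) ≠ 0 := by exact_mod_cast hne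
  exact_mod_cast Nat.one_le_iff_ne_zero.mpr h1

/-- `dist(x, Λᶜ) ≥ 1` for `x ∈ Λ` as soon as `Λᶜ ≠ ∅` (lattice units). [folklore] -/
private theorem one_le_distC (P : Params) {j : ℕ} (Λ : Finset (Site P j)) {x : Site P j} (hx : x ∈ Λ) (hne : ∃ z, z ∉ Λ) :
    1 ≤ distC P j Λ x := by
  obtain ⟨z, hz⟩ := hne
  unfold distC
  refine le_csInf ⟨_, ⟨z, hz, rfl⟩⟩ ?_
  rintro _ ⟨w, hw, rfl⟩
  exact one_le_T_of_ne P (fun h => hw (h ▸ hx))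

/-- The window `d = 3`, `L = 3`, `a = 1`, `μ₀ = 1`, `R = 1`, `r = 2`, `b₀ = 1`, `p = 3`, `r₁ = r₂ = 1`. [folklore] -/
def Q₀ : TorusConsts := ⟨3, 3, 1, 1, 1, 2, 1, 3, 1, 1⟩

/-- The window `Q₀` is valid. [folklore] -/
private theorem Q₀_valid : Q₀.Valid where
  hd := by decide
  hL := ⟨by decide, by decide⟩
  ha := by norm_num [Q₀]
  hμ₀ := by norm_num [Q₀]
  hRr := by norm_num [Q₀]
  hr := by norm_num [Q₀]
  hb₀ := by norm_num [Q₀]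
  hr₁ := by norm_num [Q₀]
  hr₂ := by norm_num [Q₀]

/-- The torus `d = 3`, `L = 3`, `m = K = 1` (ε = 1/3; `T^{(1)}` has 6 sites per direction, `T^{(2)}` has 2). [folklore] -/
def P₀ : Params := ⟨3, 3, 1, 1, by decide, ⟨by decide, by decide⟩⟩

/-- `L^1ε = 3·3⁻¹ = 1`. [folklore] -/
private theorem P₀_spacing_one : P₀.spacing 1 = 1 := by
  simp [Params.spacing, Params.eps, P₀]

/-- two coarse sites of `T^{(2)}`. [folklore] -/
private def y₀ : Site P₀ 2 := fun _ => 0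

/-- two coarse sites of `T^{(2)}`. [folklore] -/
private def y₁ : Site P₀ 2 := fun _ => 1

/-- they are distinct (`T^{(2)} = (ℤ/2)³`). [folklore] -/
private theorem y₀_ne_y₁ : y₀ ≠ y₁ := by
  intro h
  have h1 := congrFun h ⟨0, P₀.hd⟩
  simp only [y₀, y₁] at h1
  exact zero_ne_one h1

/-- An instance at step `k = 1` on `P₀`: `Λ₀^{(1)′} = T^{(2)} ∖ {y₀}` (one large-field block removed), `B = 0`. [folklore] -/
def ι₁ : TorusInst Q₀ where
  P := P₀
  hd := rfl
  hL := rfl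
  j := 1
  hj := le_rfl
  hjK := by decide
  hsp := by rw [P₀_spacing_one]
  Λ₀' := Finset.univ.erase y₀
  B := fun _ => 0

/-- the index type of the family is inhabited. [folklore] -/
instance : Nonempty (TorusInst Q₀) := ⟨ι₁⟩

/-- `r(L^1ε) = r(1) = 1` on `ι₁`. [folklore] -/
private theorem ι₁_R : ι₁.R = 1 := by
  simp [TorusInst.R, TorusInst.ℓ, B2.rFn, ι₁, P₀_spacing_one, Q₀]

/-- THE DEEP SET IS NON-EMPTY on `ι₁`: the centre of the block `B(y₁)` is at distance `≥ 1 = r(L^1ε)` from the removed block, so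
(2.81) is asserted at a point. [folklore] -/
private theorem emb_y₁_mem_deep : emb y₁ ∈ ι₁.deep := by
  have hjK : (1 : ℕ) + 1 ≤ P₀.m + P₀.K := by decide
  have hb₁ : blockOf (emb (P := P₀) (j := 1) y₁) = y₁ := Site.blockOf_emb hjK y₁
  have hb₀ : blockOf (emb (P := P₀) (j := 1) y₀) = y₀ := Site.blockOf_emb hjK y₀
  have hΛ : emb y₁ ∈ ι₁.Λ₀ := by
    refine Finset.mem_filter.mpr ⟨Finset.mem_univ _, ?_⟩
    show blockOf (emb (P := P₀) (j := 1) y₁) ∈ Finset.univ.erase y₀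
    rw [hb₁]
    exact Finset.mem_erase.mpr ⟨y₀_ne_y₁.symm, Finset.mem_univ _⟩
  refine Finset.mem_filter.mpr ⟨hΛ, ?_⟩
  rw [ι₁_R]
  refine one_le_distC P₀ _ hΛ ⟨emb y₀, fun h => ?_⟩
  have h' := (Finset.mem_filter.mp h).2
  change blockOf (emb (P := P₀) (j := 1) y₀) ∈ Finset.univ.erase y₀ at h'
  rw [hb₀] at h'
  exact (Finset.mem_erase.mp h').1 rfl

/-- the deep set of `ι₁` is non-empty. [folklore] -/
private theorem ι₁_deep_nonempty : ι₁.deep.Nonempty := ⟨_, emb_y₁_mem_deep⟩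

/-- the restrictions (2.17) are satisfiable on `ι₁` (the zero field satisfies them), so `lemma25Printed_torus` asserts its
conclusion non-vacuously there: a valid window, an instance, a satisfied hypothesis, a non-empty deep set. [folklore] -/
private theorem ι₁_restr : (toKM Q₀ Q₀_valid ι₁).Restr := by
  have hp : 0 ≤ ι₁.p := ι₁.p_nonneg Q₀_valid
  have ht : 0 ≤ ι₁.tB := ι₁.tB_nonneg Q₀_valid
  refine ⟨fun x' _ => ?_, fun x _ x' _ _ => ?_⟩
  · show |(0 : ℝ)| ≤ ι₁.tB * ι₁.p
    rw [abs_zero]; positivity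
  · show |(0 : ℝ) - 0| ≤ ι₁.p * (Q₀.r₁ + Q₀.r₂ * T ι₁.P ι₁.j x x')
    rw [sub_zero, abs_zero]
    have : 0 ≤ T ι₁.P ι₁.j x x' := T_nonneg _ _ _ _
    have h1 : (0 : ℝ) ≤ Q₀.r₁ := Q₀_valid.hr₁
    have h2 : (0 : ℝ) ≤ Q₀.r₂ := Q₀_valid.hr₂
    positivity

/-- non-vacuity of the row statement itself for the physical window: the conclusion of (2.81) evaluated on `ι₁`. -/
example : (famTorus Q₀ Q₀_valid ι₁).dev281a ≤ (consts Q₀ Q₀_valid).O1 * (famTorus Q₀ Q₀_valid ι₁).p := by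
  obtain h := (toKM Q₀ Q₀_valid ι₁).dev281a_le (consts_valid Q₀ Q₀_valid) ι₁_restr
  exact h

end

end Literature.MathematicalPhysics.QuantumFieldTheory.Balaban1983to89.B2Lemma25Torus
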